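import Literature.Geometry.Lorentzian.BogovskiiKernelBaseDeriv
import Literature.Geometry.Lorentzian.BogovskiiH1Bound
import HarnessLib

/-!
# The first-derivative kernel `K₁` of the conic Bogovskiĭ operator

(trunk G08 = T-LORENTZ; family `gr`; namespace `Literature.Geometry.Lorentzian.MaoOhTao`.)

Mao–Oh–Tao (arXiv:2308.13031), Lemma 2.3.  The kernel of `∂_k S_η` is the first `z`-derivative of the classical kernel
`Ψ_y(z) = zᵢzⱼQ₂[η](z; y)`,

  `K₁[η](z; y) = (δ_ik zⱼ + δ_jk zᵢ) Q₂[η](z; y) + zᵢzⱼ Q₃[∂_kη](z; y)`   (`bogovskiiK1`),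

written out as a function defined everywhere (`pd_classicalKernel_eq_bogovskiiK1`: it is `∂_kΨ_y` off the origin).
Recorded: the representation `∂_k (S_η h)(x) = ∫ K₁[η](x − y; y) h(y) dy` for `h ∈ C¹_c`
(`pd_bogovskiiS_eq_integral_bogovskiiK1`, a repackaging of `pd_bogovskiiS_eq_integral_kernelDeriv`), the size bound
`|K₁| ≤ M(4D³ + 2D⁴)/|z|²`, vanishing for `|z| > (R + |y|)₊`, `D_z K₁ e_l = K₂` and differentiability off the origin,
the base-point rule `∂_{y_a}K₁[η] = K₁[∂_aη]`, continuity off the origin and joint measurability.  These are the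
inputs of the (S3) decomposition `∂_k S_η(∂_l f) = N_ε + A_ε − B_ε − L_ε` (smooth truncation and one integration by
parts).

## References

* Y. Mao, S.-J. Oh, T. Tao, arXiv:2308.13031 (2023), Lemma 2.3, pp. 8–9 (key `MaoOhTao2023`).
-/

noncomputable section

open scoped RealInnerProductSpace Topology
open Filter MeasureTheory Set Metric Function

namespace Literature.Geometry.Lorentzian

namespace MaoOhTao

variable {η : E3 → ℝ} {R : ℝ}

/-- The **first-derivative kernel** `K₁[η](z; y) = (δ_ik zⱼ + δ_jk zᵢ) Q₂[η](z; y) + zᵢzⱼ Q₃[∂_kη](z; y)` of `∂_k S_η`.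
[cite: MaoOhTao2023, Lemma 2.3] -/
def bogovskiiK1 (η : E3 → ℝ) (y : E3) (i j k : Fin 3) (z : E3) : ℝ :=
  ((if i = k then 1 else 0) * z j + (if j = k then 1 else 0) * z i) * bogovskiiQ η y 2 z +
    z i * z j * bogovskiiQ (pd k η) y 3 z

/-- `∂_kΨ_y = K₁` off the origin (`η ∈ C¹`). [cite: MaoOhTao2023, Lemma 2.3] -/
theorem pd_classicalKernel_eq_bogovskiiK1 (hη : ContDiff ℝ 1 η) (hR : ∀ z : E3, R < ‖z‖ → η z = 0) (y : E3)
    (i j k : Fin 3) {z : E3} (hz : z ≠ 0) :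
    pd k (fun z : E3 ↦ z i * z j * bogovskiiQ η y 2 z) z = bogovskiiK1 η y i j k z :=
  pd_classicalKernel_eq hη hR y i j k hz

/-- `K₁(0; y) = 0`. [folklore] -/
theorem bogovskiiK1_zero (η : E3 → ℝ) (y : E3) (i j k : Fin 3) : bogovskiiK1 η y i j k 0 = 0 := by
  simp [bogovskiiK1]

/-- `K₁` vanishes for `|z| > (R + |y|)₊`. [folklore] -/
theorem bogovskiiK1_eq_zero_of_lt (hR : ∀ z : E3, R < ‖z‖ → η z = 0) (y : E3) (i j k : Fin 3) {z : E3}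
    (hz : max (R + ‖y‖) 0 < ‖z‖) : bogovskiiK1 η y i j k z = 0 := by
  have hRk : ∀ z : E3, R < ‖z‖ → pd k η z = 0 := fun z hz ↦ pd_eq_zero_of_norm_lt hR k z hz
  simp only [bogovskiiK1, bogovskiiQ_eq_zero_of_lt hR y 2 hz, bogovskiiQ_eq_zero_of_lt hRk y 3 hz, mul_zero, add_zero]

/-- **Size**: `|K₁(z; y)| ≤ M(4D³ + 2D⁴)/|z|²` for `|η|, |∂η| ≤ M`, `|y| ≤ ρ`, `D = (R + ρ)₊` (all `z`). [cite: MaoOhTao2023, Lemma 2.3] -/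
theorem abs_bogovskiiK1_le (hη : ContDiff ℝ 1 η) (hR : ∀ z : E3, R < ‖z‖ → η z = 0) {M : ℝ} (hM0 : ∀ w, |η w| ≤ M)
    (hM1 : ∀ a w, |pd a η w| ≤ M) {ρ : ℝ} {y : E3} (hy : ‖y‖ ≤ ρ) (i j k : Fin 3) (z : E3) :
    |bogovskiiK1 η y i j k z| ≤ M * (4 * (max (R + ρ) 0) ^ 3 + 2 * (max (R + ρ) 0) ^ 4) / ‖z‖ ^ 2 := by
  by_cases hz : z = 0
  · subst hz; simp [bogovskiiK1_zero]
  rw [← pd_classicalKernel_eq_bogovskiiK1 hη hR y i j k hz]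
  exact abs_pd_classicalKernel_le hη hR hM0 hM1 hy i j k hz

/-- **`K₁` is differentiable off the origin with `D_zK₁ e_l = K₂`** (`η ∈ C²`). [cite: MaoOhTao2023, Lemma 2.3] -/
theorem differentiableAt_bogovskiiK1 (hη : ContDiff ℝ 2 η) (hR : ∀ z : E3, R < ‖z‖ → η z = 0) (y : E3) (i j k : Fin 3)
    {z : E3} (hz : z ≠ 0) :
    DifferentiableAt ℝ (bogovskiiK1 η y i j k) z ∧
      ∀ l, fderiv ℝ (bogovskiiK1 η y i j k) z (e l) = bogovskiiK2 η y i j k l z := by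
  have h1 : ContDiff ℝ 1 η := hη.of_le (by norm_cast)
  have hev : bogovskiiK1 η y i j k =ᶠ[𝓝 z] pd k (fun z : E3 ↦ z i * z j * bogovskiiQ η y 2 z) := by
    filter_upwards [isOpen_compl_singleton.mem_nhds hz] with w hw
    exact (pd_classicalKernel_eq_bogovskiiK1 h1 hR y i j k hw).symm
  refine ⟨(differentiableAt_pd_classicalKernel hη hR y i j k hz).congr_of_eventuallyEq hev, fun l ↦ ?_⟩
  rw [hev.fderiv_eq]
  exact fderiv_pd_classicalKernel_apply_e hη hR y i j k l hz

/-- `K₁(·; y)` is continuous off the origin (`η ∈ C²`). [folklore] -/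
theorem continuousOn_bogovskiiK1 (hη : ContDiff ℝ 2 η) (hR : ∀ z : E3, R < ‖z‖ → η z = 0) (y : E3) (i j k : Fin 3) :
    ContinuousOn (bogovskiiK1 η y i j k) {0}ᶜ := fun _ hz ↦
  ((differentiableAt_bogovskiiK1 hη hR y i j k hz).1).continuousAt.continuousWithinAt

/-- **Base-point rule** `∂_{y_a}K₁[η](z; y) = K₁[∂_aη](z; y)` (`η ∈ C²`, `z ≠ 0`). [cite: MaoOhTao2023, Lemma 2.3] -/
theorem hasFDerivAt_bogovskiiK1_base (hη : ContDiff ℝ 2 η) (hR : ∀ z : E3, R < ‖z‖ → η z = 0) (i j k : Fin 3)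
    {z : E3} (hz : z ≠ 0) (y : E3) :
    DifferentiableAt ℝ (fun y ↦ bogovskiiK1 η y i j k z) y ∧
      ∀ a : Fin 3, fderiv ℝ (fun y ↦ bogovskiiK1 η y i j k z) y (e a) = bogovskiiK1 (pd a η) y i j k z := by
  have h1 : ContDiff ℝ 1 η := hη.of_le (by norm_cast)
  obtain ⟨hkη, hRk⟩ := contDiff_pd_and_vanish (n := 1) hη hR k
  have dQ2 := differentiableAt_bogovskiiQ_base h1 hR 2 hz y
  have dQ3 := differentiableAt_bogovskiiQ_base hkη hRk 3 hz y
  have dT1 : DifferentiableAt ℝ (fun y ↦ ((if i = k then (1 : ℝ) else 0) * z j + (if j = k then 1 else 0) * z i) *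
      bogovskiiQ η y 2 z) y := dQ2.const_mul _
  have dT2 : DifferentiableAt ℝ (fun y ↦ z i * z j * bogovskiiQ (pd k η) y 3 z) y := dQ3.const_mul _
  have hK : (fun y ↦ bogovskiiK1 η y i j k z) = fun y ↦
      ((if i = k then (1 : ℝ) else 0) * z j + (if j = k then 1 else 0) * z i) * bogovskiiQ η y 2 z +
        z i * z j * bogovskiiQ (pd k η) y 3 z := rfl
  refine ⟨by rw [hK]; exact dT1.add dT2, fun a ↦ ?_⟩
  rw [hK, fderiv_fun_add dT1 dT2, fderiv_const_mul dQ2, fderiv_const_mul dQ3]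
  simp only [_root_.add_apply, _root_.smul_apply, smul_eq_mul]
  rw [fderiv_bogovskiiQ_base_e h1 hR 2 hz y a, fderiv_bogovskiiQ_base_e hkη hRk 3 hz y a]
  have c : pd a (pd k η) = pd k (pd a η) := funext fun x ↦ pd_pd_comm hη.contDiffAt a k
  rw [c]
  rfl

/-- Joint measurability of `(z, y) ↦ K₁(z; y)` (`η ∈ C¹`). [folklore] -/
theorem measurable_bogovskiiK1_uncurry (hη : ContDiff ℝ 1 η) (i j k : Fin 3) :
    Measurable fun p : E3 × E3 ↦ bogovskiiK1 η p.2 i j k p.1 := by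
  have hk : Continuous (pd k η) := (contDiff_pd (n := 0) hη k).continuous
  have mi : Measurable fun p : E3 × E3 ↦ p.1 i := (EuclideanSpace.proj (𝕜 := ℝ) i).continuous.measurable.comp
    measurable_fst
  have mj : Measurable fun p : E3 × E3 ↦ p.1 j := (EuclideanSpace.proj (𝕜 := ℝ) j).continuous.measurable.comp
    measurable_fst
  unfold bogovskiiK1
  exact (((mj.const_mul _).add (mi.const_mul _)).mul (measurable_bogovskiiQ_uncurry hη.continuous 2)).add
    ((mi.mul mj).mul (measurable_bogovskiiQ_uncurry hk 3))

/-- **The kernel of `∂_k S_η`**: for `η ∈ C¹` vanishing off `B̄_R` and `h ∈ C¹_c`,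
`∂_k (S_η h)ᵢⱼ(x) = ∫ K₁[η](x − y; y) h(y) dy`. [cite: MaoOhTao2023, Lemma 2.3] -/
theorem pd_bogovskiiS_eq_integral_bogovskiiK1 (hη : ContDiff ℝ 1 η) (hR : ∀ z : E3, R < ‖z‖ → η z = 0)
    {h : E3 → ℝ} (hh : ContDiff ℝ 1 h) (hhc : HasCompactSupport h) (i j k : Fin 3) (x : E3) :
    pd k (bogovskiiS η h i j) x = ∫ y : E3, bogovskiiK1 η y i j k (x - y) * h y := by
  rw [pd_bogovskiiS_eq_integral_kernelDeriv hη hR hh hhc i j k x]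
  refine integral_congr_ae (ae_of_all _ fun y ↦ ?_)
  show (((x - y) i * (x - y) j) • (∫ s in Ioi (1 : ℝ), (s ^ 3) • fderiv ℝ η (s • (x - y) + y)) +
      (∫ s in Ioi (1 : ℝ), η (s • (x - y) + y) * s ^ 2) •
        ((x - y) i • EuclideanSpace.proj (𝕜 := ℝ) j + (x - y) j • EuclideanSpace.proj (𝕜 := ℝ) i)) (e k) * h y =
    bogovskiiK1 η y i j k (x - y) * h y
  by_cases hxy : x - y = 0
  · rw [hxy, bogovskiiK1_zero]
    simp
  congr 1
  have hint : Integrable (fun s : ℝ ↦ (s ^ 3) • fderiv ℝ η (s • (x - y) + y)) (volume.restrict (Ioi 1)) :=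
    integrable_pow_smul_fderiv_ray (m := 2) hη hR y hxy
  simp only [_root_.add_apply, _root_.smul_apply, smul_eq_mul, bogovskiiK1, bogovskiiQ_apply]
  rw [ContinuousLinearMap.integral_apply hint (e k)]
  have hQ3 : ∫ s in Ioi (1 : ℝ), ((s ^ 3) • fderiv ℝ η (s • (x - y) + y)) (e k) =
      ∫ s in Ioi (1 : ℝ), pd k η (s • (x - y) + y) * s ^ 3 := by
    refine integral_congr_ae (ae_of_all _ fun s ↦ ?_)
    simp only [FunLike.coe_smul, Pi.smul_apply, smul_eq_mul, pd]
    ring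
  rw [hQ3]
  simp [e]
  split_ifs <;> simp_all <;> ring

end MaoOhTao

end Literature.Geometry.Lorentzian
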